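import Summits.FinalStateConjecture.FinalStateConjecture.Theorems.TameCensorship.Negative.GenericityAndFails
import Literature.Geometry.Lorentzian.TameFamilyOffCompact
import Literature.Geometry.Lorentzian.TrivialDataAdmissible

/-!
# TAME Christodoulou genericity is not closed under conjunction — part 1: the tame model families
# (negative-side support for crux `CaptureSufficesTame`, item `stmt-FinalStateConjecture-17270`,
# route `PhaseMixingCapture`, rank 6)

The crux `CaptureSufficesTame := NearExtremalKappaCapture → BulkKerrCaptureC2 →
WeakCosmicCensorshipTame → FinalStateConjecture` has a TAME-generic hypothesis (`h₃`, tame weak cosmic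
censorship) and a TAME-generic conclusion (the re-typed summit, `IsTameChristodoulouGeneric … 1`,
`Literature/Geometry/Lorentzian/TameGenericity.lean`); every line on file produces the conclusion's
genericity by COMPOSITION ALONG CENSORED CURVES (`InitialDataSet.isTameChristodoulouGeneric_of_relative`)
on the grounds that "tame genericities do not intersect". The sequel `TameGenericityAndFails.lean` proves
that slogan for the summit's TAME notion (`not_isTameChristodoulouGeneric_and_closed`); for the older
topology-free notion it is `TameCensorship/Negative/GenericityAndFails.lean`, whose witness curves
`k_c = k + (affine profile) • δ` are not asymptotically flat, hence not tame.

This part builds the TAME MODEL FAMILIES on the Minkowski slice (all proved, no named facts):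

* `famT D a b c`: `k_c = k + (a(c₀) ψ₀ + b(c₀) ψ₁) • δ` with BUMPS `ψ₀`, `ψ₁` supported in balls of
  radius `1/2` about `0` and `e`, so that the observable `Φ(D) = (k(0)(e,e), k(e)(e,e))` is translated
  by `(a(c₀), b(c₀))` (`Φ_famT`) exactly as for the affine families `fam` of `GenericityModel.lean`;
* `tameClass`: data `(δ, k)` with `k = 0` outside the ball of radius `2` — stable under `famT`, every
  member Dafermos–Rodnianski flat of mass `0` on the sole end `trivialAFEnd` (`isSAF_of_mem_tameClass`);
* `isTameDataFamily_famT` — the families are TAME on the collared end `trivialAFEnd.restrict _`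
  (jointly smooth and constant off the compact ball `{‖y‖ ≤ 2}`:
  `InitialDataSet.isTameDataFamily_restrict_of_agree_off_compact_one`);
* `isImmersedAtZero_famT_fst/snd` — and IMMERSED at `0` as soon as `a'(0) ≠ 0` (resp. `b'(0) ≠ 0`):
  the `c`-derivative of the marker `k_c(0)(e,e) = k(0)(e,e) + a(c₀)` is `a'(0) · (coordinate of v)`.

Christodoulou, CQG 16 (1999) A23, p. A24 (compactly supported witness lines `α₀ + c f` in a fixed
space); Dafermos–Rodnianski arXiv:0811.0354, App. B.2.3 (the weighted class).
-/

-- the problem namespace `FinalStateConjecture.FinalStateConjecture` (single-conjunct summit) trips dupNamespace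
set_option linter.dupNamespace false

noncomputable section

open Bundle TopologicalSpace Manifold Set Function Metric
open scoped ContDiff Topology InnerProductSpace RealInnerProductSpace

namespace Summit.FinalStateConjecture.FinalStateConjecture.Theorems.CaptureSufficesTame.Negative

open Literature.Geometry.Lorentzian
open Summit.FinalStateConjecture.FinalStateConjecture.Theorems.TameCensorship.Negative

/-! ### Bumps at `0` and at `e` -/

/-- `bump t = smoothTransition (2 - 8t)`: smooth, `= 1` for `t ≤ 1/8`, `= 0` for `t ≥ 1/4`. -/
def bump (t : ℝ) : ℝ := Real.smoothTransition (2 - 8 * t)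

/-- `bump` is smooth. -/
private theorem contDiff_bump : ContDiff ℝ ∞ bump :=
  Real.smoothTransition.contDiff.comp (contDiff_const.sub (contDiff_const.mul contDiff_id))

/-- `bump 0 = 1`. -/
private theorem bump_zero : bump 0 = 1 :=
  Real.smoothTransition.one_of_one_le (by norm_num)

/-- `bump t = 0` for `t ≥ 1/4`. -/
private theorem bump_eq_zero {t : ℝ} (ht : 1 / 4 ≤ t) : bump t = 0 :=
  Real.smoothTransition.zero_of_nonpos (by linarith)

/-- The bump `ψ₀(x) = bump ‖x‖²` centred at `0` (support in the ball of radius `1/2`). -/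
def ψ₀ (x : E3) : ℝ := bump (‖x‖ ^ 2)

/-- The bump `ψ₁(x) = bump ‖x - e‖²` centred at `e`. -/
def ψ₁ (x : E3) : ℝ := bump (‖x - e‖ ^ 2)

/-- `ψ₀` is smooth. -/
theorem contDiff_ψ₀ : ContDiff ℝ ∞ ψ₀ := contDiff_bump.comp (contDiff_norm_sq ℝ)

/-- `ψ₁` is smooth. -/
theorem contDiff_ψ₁ : ContDiff ℝ ∞ ψ₁ :=
  contDiff_bump.comp ((contDiff_norm_sq ℝ).comp (contDiff_id.sub contDiff_const))

/-- `ψ₀ 0 = 1`. -/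
@[simp] theorem ψ₀_zero : ψ₀ 0 = 1 := by simp [ψ₀, bump_zero]

/-- `ψ₀ e = 0` (`‖e‖ = 1 ≥ 1/2`). -/
@[simp] theorem ψ₀_e : ψ₀ e = 0 := by
  simp only [ψ₀, norm_e, one_pow]
  exact bump_eq_zero (by norm_num)

/-- `ψ₁ 0 = 0`. -/
@[simp] theorem ψ₁_zero : ψ₁ 0 = 0 := by
  simp only [ψ₁, zero_sub, norm_neg, norm_e, one_pow]
  exact bump_eq_zero (by norm_num)

/-- `ψ₁ e = 1`. -/
@[simp] theorem ψ₁_e : ψ₁ e = 1 := by simp [ψ₁, bump_zero]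

/-- The bump at `0` vanishes outside the ball of radius `2`. -/
theorem ψ₀_eq_zero_of_two_le {x : E3} (hx : 2 ≤ ‖x‖) : ψ₀ x = 0 :=
  bump_eq_zero (by nlinarith)

/-- The bump at `e` vanishes outside the ball of radius `2`. -/
theorem ψ₁_eq_zero_of_two_le {x : E3} (hx : 2 ≤ ‖x‖) : ψ₁ x = 0 := by
  refine bump_eq_zero ?_
  have h1 : 1 ≤ ‖x - e‖ := by
    have := norm_sub_norm_le x e
    rw [norm_e] at this
    linarith
  nlinarith

/-! ### The compactly supported shift of `k` and the tame witness family -/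

/-- The ambient section `x ↦ (a ψ₀ x + b ψ₁ x) • δ`. -/
def βT (a b : ℝ) (x : E3) : Bil :=
  (a * ψ₀ x + b * ψ₁ x) • (innerSL ℝ (E := E3) : Bil)

/-- Evaluation of the section (by `rfl`). -/
theorem βT_apply (a b : ℝ) (x v w : E3) : βT a b x v w = (a * ψ₀ x + b * ψ₁ x) * ⟪v, w⟫ := rfl

/-- The section is symmetric. -/
theorem βT_symm (a b : ℝ) (x v w : E3) : βT a b x v w = βT a b x w v := by
  rw [βT_apply, βT_apply, real_inner_comm v w]

/-- The section vanishes outside the ball of radius `2`. -/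
theorem βT_eq_zero_of_two_le (a b : ℝ) {x : E3} (hx : 2 ≤ ‖x‖) : βT a b x = 0 := by
  ext v w
  rw [βT_apply, ψ₀_eq_zero_of_two_le hx, ψ₁_eq_zero_of_two_le hx]
  simp

/-- Joint smoothness of `(a, b, x) ↦ βT a b x`. -/
theorem contDiff_βT : ContDiff ℝ ∞ (fun q : (ℝ × ℝ) × E3 ↦ βT q.1.1 q.1.2 q.2) := by
  have hs : ContDiff ℝ ∞ (fun q : (ℝ × ℝ) × E3 ↦ q.1.1 * ψ₀ q.2 + q.1.2 * ψ₁ q.2) :=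
    ((contDiff_fst.comp contDiff_fst).mul (contDiff_ψ₀.comp contDiff_snd)).add
      ((contDiff_snd.comp contDiff_fst).mul (contDiff_ψ₁.comp contDiff_snd))
  exact contDiffOn_univ.1 (contDiffOn_smul_const' hs.contDiffOn (innerSL ℝ (E := E3) : Bil))

/-- The section restricted to the slice is smooth as a plain map. -/
theorem contMDiff_βT_slice (a b : ℝ) :
    ContMDiff 𝓘(ℝ, E3) 𝓘(ℝ, Bil) ∞ (fun x : Minkowski.slice ↦ βT a b x) :=
  ((contDiff_βT.comp ((contDiff_const (c := (a, b))).prodMk contDiff_id)).contMDiff).comp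
    contMDiff_subtype_val

/-- The one-parameter family `k_c = k + βT (a c₀) (b c₀)` (bumped version of `fam`). -/
def famT (D : SliceData) (a b : ℝ → ℝ) (c : EuclideanSpace ℝ (Fin 1)) : SliceData :=
  addK D (fun x ↦ βT (a (c 0)) (b (c 0)) x) (fun x v w ↦ βT_symm _ _ x v w)
    (contMDiff_βT_slice _ _)

/-- The family does not change the metric `h`. -/
@[simp] theorem famT_h (D : SliceData) (a b : ℝ → ℝ) (c : EuclideanSpace ℝ (Fin 1)) :
    (famT D a b c).h = D.h := rfl

/-- Evaluation of `k` along the family (by `rfl`). -/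
theorem famT_k_apply (D : SliceData) (a b : ℝ → ℝ) (c : EuclideanSpace ℝ (Fin 1))
    (x : Minkowski.slice) (v w : E3) :
    (famT D a b c).k x v w = D.k x v w + βT (a (c 0)) (b (c 0)) x v w := rfl

/-- The observable at `p₀` along the family: `k(0)(e,e) + a(c₀)`. -/
theorem famT_k_p₀ (D : SliceData) (a b : ℝ → ℝ) (c : EuclideanSpace ℝ (Fin 1)) :
    (famT D a b c).k p₀ e e = D.k p₀ e e + a (c 0) := by
  rw [famT_k_apply, βT_apply, coe_p₀, ψ₀_zero, ψ₁_zero, inner_e_e]; ring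

/-- The observable at `p₁` along the family: `k(e)(e,e) + b(c₀)`. -/
theorem famT_k_p₁ (D : SliceData) (a b : ℝ → ℝ) (c : EuclideanSpace ℝ (Fin 1)) :
    (famT D a b c).k p₁ e e = D.k p₁ e e + b (c 0) := by
  rw [famT_k_apply, βT_apply, coe_p₁, ψ₀_e, ψ₁_e, inner_e_e]; ring

/-- The observable along the family is translated by `(a(c₀), b(c₀))`. -/
theorem Φ_famT (D : SliceData) (a b : ℝ → ℝ) (c : EuclideanSpace ℝ (Fin 1)) :
    Φ (famT D a b c) = ((Φ D).1 + a (c 0), (Φ D).2 + b (c 0)) := by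
  simp only [Φ, famT_k_p₀, famT_k_p₁]

/-- At the parameter `0` the family passes through `D` (if `a 0 = b 0 = 0`). -/
theorem famT_zero (D : SliceData) (a b : ℝ → ℝ) (ha : a 0 = 0) (hb : b 0 = 0) :
    famT D a b 0 = D := by
  refine sliceData_ext rfl (funext fun x ↦ ?_)
  ext v w
  rw [famT_k_apply, βT_apply]
  simp [ha, hb]

/-- Off the ball of radius `2` every member has the tensor `k` of `D`. -/
theorem famT_k_of_two_le (D : SliceData) (a b : ℝ → ℝ) (c : EuclideanSpace ℝ (Fin 1))
    {y : Minkowski.slice} (hy : 2 ≤ ‖(y : E3)‖) : (famT D a b c).k y = D.k y := by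
  ext v w
  rw [famT_k_apply, βT_eq_zero_of_two_le _ _ hy]
  simp

/-- The family is jointly smooth (`IsSmoothDataFamily 1`). -/
theorem isSmoothDataFamily_famT (D : SliceData) {a b : ℝ → ℝ} (ha : ContDiff ℝ ∞ a)
    (hb : ContDiff ℝ ∞ b) : InitialDataSet.IsSmoothDataFamily 1 (famT D a b) := by
  refine ⟨?_, ?_⟩
  · exact D.h.contMDiff.comp contMDiff_snd
  intro q
  refine (contMDiffAt_totalSpace_bilin_iff Minkowski.slice Prod.snd
    (fun q : EuclideanSpace ℝ (Fin 1) × Minkowski.slice ↦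
      kBil D q.2 + βT (a (q.1 0)) (b (q.1 0)) (q.2 : E3)) q).2 ⟨contMDiffAt_snd, ?_⟩
  have h0 : ContDiff ℝ ∞ (fun c : EuclideanSpace ℝ (Fin 1) ↦ c 0) :=
    contDiff_piLp_apply (p := 2) (i := (0 : Fin 1))
  have h1 : ContDiff ℝ ∞ (fun q : EuclideanSpace ℝ (Fin 1) × E3 ↦
      βT (a (q.1 0)) (b (q.1 0)) q.2) :=
    contDiff_βT.comp (((ha.comp (h0.comp contDiff_fst)).prodMk
      (hb.comp (h0.comp contDiff_fst))).prodMk contDiff_snd)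
  have h2 : ContMDiff (𝓘(ℝ, EuclideanSpace ℝ (Fin 1)).prod 𝓘(ℝ, E3))
      𝓘(ℝ, EuclideanSpace ℝ (Fin 1) × E3) ∞
      (fun q : EuclideanSpace ℝ (Fin 1) × Minkowski.slice ↦ (q.1, (q.2 : E3))) :=
    contMDiff_fst.prodMk_space (contMDiff_subtype_val.comp contMDiff_snd)
  exact (((contMDiff_kBil D).comp contMDiff_snd) q).add ((h1.comp_contMDiff h2) q)

/-! ### The class: flat metric, `k` supported in the ball of radius `2` -/

/-- The admissible class of the model: `h = δ` and `k = 0` outside the ball of radius `2`. -/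
def tameClass : Set SliceData :=
  {D | D.h = trivialData.h ∧ ∀ y : Minkowski.slice, 2 ≤ ‖(y : E3)‖ → D.k y = 0}

/-- The trivial datum is in the class. -/
theorem trivialData_mem_tameClass : trivialData ∈ tameClass :=
  ⟨rfl, fun y _ ↦ trivialData_k y⟩

/-- The class is stable under the bumped families. -/
theorem famT_mem_tameClass {D : SliceData} (hD : D ∈ tameClass) (a b : ℝ → ℝ)
    (c : EuclideanSpace ℝ (Fin 1)) : famT D a b c ∈ tameClass :=
  ⟨hD.1, fun y hy ↦ by rw [famT_k_of_two_le D a b c hy, hD.2 y hy]⟩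

/-- Every member of the class is Dafermos–Rodnianski flat of mass `0` on `trivialAFEnd` (it agrees
with the trivial datum on the far region `{2 < ‖y‖}`). -/
theorem isSAF_of_mem_tameClass {D : SliceData} (hD : D ∈ tameClass) :
    trivialAFEnd.IsStronglyAsymptoticallyFlatDR D 0 := by
  have h0 : trivialAFEnd.IsStronglyAsymptoticallyFlatDR trivialData 0 :=
    trivialAFEnd_isStronglyAsymptoticallyFlatCK_holds.isStronglyAsymptoticallyFlatDR
  refine h0.congr_of_eqOn_far (R₀ := 2) (fun q _ ↦ by rw [hD.1]) (fun q hq ↦ ?_)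
  rw [far_trivialAFEnd (by norm_num)] at hq
  rw [hD.2 q (le_of_lt hq), trivialData_k]

/-- The inner radius of `trivialAFEnd` is less than `2`. -/
theorem trivialAFEnd_R_lt_two : trivialAFEnd.R < 2 := by
  rw [trivialAFEnd_R]; norm_num

/-- The closed ball of radius `2` in the slice is compact. -/
theorem isCompact_ball_two :
    IsCompact {y : Minkowski.slice | ‖(y : E3)‖ ≤ 2} := by
  have hset : {y : Minkowski.slice | ‖(y : E3)‖ ≤ 2} =
      ((↑) : Minkowski.slice → E3) ⁻¹' closedBall (0 : E3) 2 := by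
    ext y
    simp
  rw [hset]
  have hcl : IsClosed ((Minkowski.slice : Opens E3) : Set E3) := by
    simp [Minkowski.slice]
  exact hcl.isClosedEmbedding_subtypeVal.isCompact_preimage (isCompact_closedBall (0 : E3) 2)

/-- **The bumped family through a member of the class is TAME** on the collared end
`trivialAFEnd.restrict _` (jointly smooth, constant off the compact ball of radius `2`, base member
DR-flat of mass `0` on the sole end `trivialAFEnd`). -/
theorem isTameDataFamily_famT {D : SliceData} (hD : D ∈ tameClass) {a b : ℝ → ℝ}
    (ha : ContDiff ℝ ∞ a) (hb : ContDiff ℝ ∞ b) :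
    InitialDataSet.IsTameDataFamily (trivialAFEnd.restrict trivialAFEnd_R_lt_two.le) 1
      (famT D a b) := by
  refine InitialDataSet.isTameDataFamily_restrict_of_agree_off_compact_one
    (isSmoothDataFamily_famT D ha hb) isSoleEnd_trivialAFEnd
    (isSAF_of_mem_tameClass (famT_mem_tameClass hD a b 0)) isCompact_ball_two
    (fun c x hx ↦ ⟨rfl, ?_⟩) trivialAFEnd_R_lt_two
  have hx' : 2 ≤ ‖(x : E3)‖ := le_of_lt (not_le.1 hx)
  rw [famT_k_of_two_le D a b c hx', famT_k_of_two_le D a b 0 hx']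

/-! ### Immersion at the base parameter -/

/-- **Immersion from the first profile**: if `a` has non-zero derivative at `0`, the bumped family
is immersed at `0` (marker `c ↦ k_c(0)(e,e) = k(0)(e,e) + a(c₀)`). -/
theorem isImmersedAtZero_famT_fst (D : SliceData) {a b : ℝ → ℝ} {a' : ℝ}
    (ha : HasDerivAt a a' 0) (ha' : a' ≠ 0) :
    InitialDataSet.IsImmersedAtZero 1 (famT D a b) := by
  intro v hv
  have hv0 : v 0 ≠ 0 := euclid1_ne_zero hv
  refine ⟨p₀, e, e, Or.inr ?_⟩
  have hline : (fun c : EuclideanSpace ℝ (Fin 1) ↦ (famT D a b c).k p₀ e e) =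
      fun c ↦ D.k p₀ e e + a (c 0) := funext fun c ↦ famT_k_p₀ D a b c
  have hproj : HasFDerivAt (𝕜 := ℝ) (fun c : EuclideanSpace ℝ (Fin 1) ↦ c 0)
      (PiLp.proj (𝕜 := ℝ) 2 (fun _ : Fin 1 ↦ ℝ) 0) 0 :=
    PiLp.hasFDerivAt_apply 2 (0 : EuclideanSpace ℝ (Fin 1)) 0
  have hg : HasDerivAt (fun t : ℝ ↦ D.k p₀ e e + a t) a'
      ((fun c : EuclideanSpace ℝ (Fin 1) ↦ c 0) 0) := by
    have h00 : ((fun c : EuclideanSpace ℝ (Fin 1) ↦ c 0) 0 : ℝ) = 0 := rfl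
    rw [h00]
    exact ha.const_add _
  have hcomp0 := hg.comp_hasFDerivAt (0 : EuclideanSpace ℝ (Fin 1)) hproj
  have hcomp : HasFDerivAt (fun c : EuclideanSpace ℝ (Fin 1) ↦ D.k p₀ e e + a (c 0))
      (a' • PiLp.proj (𝕜 := ℝ) 2 (fun _ : Fin 1 ↦ ℝ) 0) 0 :=
    hcomp0
  rw [hline, hcomp.fderiv]
  simp only [FunLike.coe_smul, Pi.smul_apply, PiLp.proj_apply, smul_eq_mul]
  exact mul_ne_zero ha' hv0

/-- **Immersion from the second profile**: if `b` has non-zero derivative at `0`, the bumped family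
is immersed at `0` (marker `c ↦ k_c(e)(e,e) = k(e)(e,e) + b(c₀)`). -/
theorem isImmersedAtZero_famT_snd (D : SliceData) {a b : ℝ → ℝ} {b' : ℝ}
    (hb : HasDerivAt b b' 0) (hb' : b' ≠ 0) :
    InitialDataSet.IsImmersedAtZero 1 (famT D a b) := by
  intro v hv
  have hv0 : v 0 ≠ 0 := euclid1_ne_zero hv
  refine ⟨p₁, e, e, Or.inr ?_⟩
  have hline : (fun c : EuclideanSpace ℝ (Fin 1) ↦ (famT D a b c).k p₁ e e) =
      fun c ↦ D.k p₁ e e + b (c 0) := funext fun c ↦ famT_k_p₁ D a b c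
  have hproj : HasFDerivAt (𝕜 := ℝ) (fun c : EuclideanSpace ℝ (Fin 1) ↦ c 0)
      (PiLp.proj (𝕜 := ℝ) 2 (fun _ : Fin 1 ↦ ℝ) 0) 0 :=
    PiLp.hasFDerivAt_apply 2 (0 : EuclideanSpace ℝ (Fin 1)) 0
  have hg : HasDerivAt (fun t : ℝ ↦ D.k p₁ e e + b t) b'
      ((fun c : EuclideanSpace ℝ (Fin 1) ↦ c 0) 0) := by
    have h00 : ((fun c : EuclideanSpace ℝ (Fin 1) ↦ c 0) 0 : ℝ) = 0 := rfl
    rw [h00]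
    exact hb.const_add _
  have hcomp0 := hg.comp_hasFDerivAt (0 : EuclideanSpace ℝ (Fin 1)) hproj
  have hcomp : HasFDerivAt (fun c : EuclideanSpace ℝ (Fin 1) ↦ D.k p₁ e e + b (c 0))
      (b' • PiLp.proj (𝕜 := ℝ) 2 (fun _ : Fin 1 ↦ ℝ) 0) 0 :=
    hcomp0
  rw [hline, hcomp.fderiv]
  simp only [FunLike.coe_smul, Pi.smul_apply, PiLp.proj_apply, smul_eq_mul]
  exact mul_ne_zero hb' hv0

/-- The derivative of `θf n` at `0` is `1 / (4 (n + 2))`. -/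
theorem hasDerivAt_θf_zero (n : ℕ) : HasDerivAt (θf n) (1 / (4 * ((n : ℝ) + 2))) 0 := by
  have h := (Real.hasDerivAt_arctan 0).div_const (4 * ((n : ℝ) + 2))
  simp only [ne_eq, OfNat.ofNat_ne_zero, not_false_eq_true, zero_pow, add_zero, div_one] at h
  exact h

/-- … and it is non-zero. -/
theorem deriv_θf_ne_zero (n : ℕ) : (1 / (4 * ((n : ℝ) + 2))) ≠ 0 := by positivity

end Summit.FinalStateConjecture.FinalStateConjecture.Theorems.CaptureSufficesTame.Negative

end
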